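import Summits.RiemannHypothesis.RiemannHypothesis.Theorems.MotivicDoorFunctionFieldSigned
import Literature.AlgebraicGeometry.Motives.AbelianVarietyHondaTateOrdinary

/-!
# The function-field door (FF-DOOR, statement (ii)) — part 7: the sign of `c₀` and the middle coefficient
(pub-rhdoor, seat ff-2, gen 3; HONEST FRAMING: lottery ticket at the motivic door; RH probability
negligible; consolation prizes are real: a new semi-local Weil-positivity theorem, or a located gap in the
Connes–Consani programme, plus the ff-door theorem.  Nothing in this file is a statement about `ζ`.)

The door theorems are stated for HONEST data `(q, h)`: `h ∈ ℤ[X]` monic of degree `2g` with the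
coefficient functional equation `q^g c_j = q^i c_i` (`i + j = 2g`).  This file settles, WITHOUT any named
hypothesis, how far an RH-true datum can be from honest.

* `twistedFE_of_map_reciprocal` — if the complex root multiset of a monic `h` of degree `2g` is closed
  under `α ↦ q/α` and `c₀ = h(0) ≠ 0`, then `c₀ · c_j = q^i · c_i` for all `i + j = 2g` (the polynomial
  identity `x^{2g} h(q/x) = c₀ h(x)`, read coefficientwise).  [PROVED; the degree-`2g` case of part 8's
  `twistedFE_of_map_reciprocal_deg` (ff-1's `fe_of_map_reciprocal` argument with `c₀` in place of `q^g`)]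
* `coeff_zero_sq_eq_of_rh`, `coeff_zero_eq_or_eq_neg_of_rh` — for RH-true monic `h` of degree `2g`
  (`q > 0`): `c₀² = q^{2g}`, so `c₀ = q^g` or `c₀ = -q^g` — a norm-free proof of `|h(0)| = q^g`.  [PROVED]
* `coeff_half_eq_zero_of_rh_of_coeff_zero_ne` — in the branch `c₀ ≠ q^g` (equivalently `c₀ = -q^g`,
  equivalently `h` RH-true but DISHONEST) the MIDDLE COEFFICIENT VANISHES: `c_g = 0`; and
  `fe_of_rh_of_coeff_half_ne_zero` — an RH-true monic `h` of degree `2g` with `c_g ≠ 0` is honest.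
  `not_fe_iff_coeff_zero_eq_neg_of_rh` — RH-true and dishonest ⟺ `c₀ = -q^g`.  [PROVED]
* `IsOrdinaryWeilPoly.coeff_zero_eq`, `IsOrdinaryWeilPoly.fe` — HOWE 1995, PROP. (3.4) as a THEOREM:
  an ordinary Weil `q`-polynomial (`IsOrdinaryWeilPoly p q h`, Howe Def. (3.2) recorded literally in
  `Literature/…/AbelianVarietyHondaTateOrdinary.lean`) has `h(0) = q^g` and satisfies the functional
  equation — here for ANY naturals `p`, `q > 0` (Howe assumes `q` a power of the prime `p` and argues via
  real roots `±√q`; the sign argument above needs neither).  [PROVED, no named fact]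
* `X_sq_sub_C_dishonest` — the instance `h = x² - q`: RH-true, `c₀ = -q`, middle coefficient `0`,
  functional equation false.  [PROVED]

Consequence for FF-DOOR §(ii) caveat (3): the honesty hypothesis of the door theorem is AUTOMATIC for
ordinary data, and more generally for every RH-true datum with non-vanishing middle coefficient; the only
RH-true data the door's honesty clause excludes are the `c₀ = -q^g` ones, all of which have `c_g = 0`.
-/

open Polynomial
open Summit.RiemannHypothesis.RiemannHypothesis.Theorems.PfPersistence.FfAngleTwin
open Literature.AlgebraicGeometry.Motives

namespace Summit.RiemannHypothesis.RiemannHypothesis.Theorems.MotivicDoor.FunctionField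

set_option linter.dupNamespace false

/-! ## The twisted functional equation `x^{2g} h(q/x) = c₀ · h(x)` -/

/-- **Twisted FE.**  For a monic `h ∈ ℤ[X]` of degree `2g` whose complex root multiset is closed under
`α ↦ q/α` (`q > 0`) and with `c₀ = h(0) ≠ 0`: `c₀ · c_j = q^i · c_i` whenever `i + j = 2g`.
[PROVED; the case `d = 2g` of `twistedFE_of_map_reciprocal_deg` (part 8, `MotivicDoorFunctionFieldSigned`)] -/
theorem twistedFE_of_map_reciprocal {q : ℕ} (hq : 0 < q) {h : ℤ[X]} {g : ℕ} (hh : h.Monic)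
    (hdeg : h.natDegree = 2 * g) (hrec : (frobRoots h).map (fun α => (q : ℂ) / α) = frobRoots h)
    (hc0 : h.coeff 0 ≠ 0) :
    ∀ i j, i + j = 2 * g → h.coeff 0 * h.coeff j = (q : ℤ) ^ i * h.coeff i :=
  twistedFE_of_map_reciprocal_deg hq hh hdeg hrec hc0

/-! ## RH-true data: `c₀ = ± q^g`, and the dishonest branch has vanishing middle coefficient -/

/-- RH-true data (`q > 0`) have `c₀ ≠ 0`. [PROVED] -/
theorem coeff_zero_ne_zero_of_rh {q : ℕ} (hq : 0 < q) {h : ℤ[X]} (hh : h.Monic)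
    (hRH : ∀ α ∈ frobRoots h, ‖α‖ = Real.sqrt q) : h.coeff 0 ≠ 0 := by
  intro hc0
  have hroot : (0 : ℂ) ∈ frobRoots h := by
    change (0 : ℂ) ∈ (h.map (Int.castRingHom ℂ)).roots
    rw [mem_roots ((hh.map _).ne_zero), IsRoot.def, ← coeff_zero_eq_eval_zero, coeff_map, hc0, map_zero]
  have := hRH 0 hroot
  rw [norm_zero] at this
  exact (Real.sqrt_pos.2 (by exact_mod_cast hq)).ne' this.symm

/-- **Twisted FE for RH-true data**: `c₀ · c_j = q^i · c_i` (`i + j = 2g`). [PROVED] -/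
theorem twistedFE_of_rh {q : ℕ} (hq : 0 < q) {h : ℤ[X]} {g : ℕ} (hh : h.Monic)
    (hdeg : h.natDegree = 2 * g) (hRH : ∀ α ∈ frobRoots h, ‖α‖ = Real.sqrt q) :
    ∀ i j, i + j = 2 * g → h.coeff 0 * h.coeff j = (q : ℤ) ^ i * h.coeff i :=
  twistedFE_of_map_reciprocal hq hh hdeg (frobRoots_map_natCast_div_of_rh hRH)
    (coeff_zero_ne_zero_of_rh hq hh hRH)

/-- **`c₀² = q^{2g}` for RH-true monic `h` of degree `2g`** — a norm-free proof of `|h(0)| = q^g`. [PROVED] -/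
theorem coeff_zero_sq_eq_of_rh {q : ℕ} (hq : 0 < q) {h : ℤ[X]} {g : ℕ} (hh : h.Monic)
    (hdeg : h.natDegree = 2 * g) (hRH : ∀ α ∈ frobRoots h, ‖α‖ = Real.sqrt q) :
    h.coeff 0 ^ 2 = ((q : ℤ) ^ g) ^ 2 := by
  have htop : h.coeff (2 * g) = 1 := by rw [← hdeg]; exact hh.coeff_natDegree
  have := twistedFE_of_rh hq hh hdeg hRH (2 * g) 0 (by omega)
  rw [htop, mul_one] at this
  rw [sq, this]; ring

/-- **The sign dichotomy**: an RH-true monic `h` of degree `2g` has `c₀ = q^g` or `c₀ = -q^g`. [PROVED] -/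
theorem coeff_zero_eq_or_eq_neg_of_rh {q : ℕ} (hq : 0 < q) {h : ℤ[X]} {g : ℕ} (hh : h.Monic)
    (hdeg : h.natDegree = 2 * g) (hRH : ∀ α ∈ frobRoots h, ‖α‖ = Real.sqrt q) :
    h.coeff 0 = (q : ℤ) ^ g ∨ h.coeff 0 = -((q : ℤ) ^ g) :=
  sq_eq_sq_iff_eq_or_eq_neg.1 (coeff_zero_sq_eq_of_rh hq hh hdeg hRH)

/-- **The dishonest branch kills the middle coefficient**: RH-true, monic of degree `2g`, `c₀ ≠ q^g`
⇒ `c_g = 0`. [PROVED] -/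
theorem coeff_half_eq_zero_of_rh_of_coeff_zero_ne {q : ℕ} (hq : 0 < q) {h : ℤ[X]} {g : ℕ} (hh : h.Monic)
    (hdeg : h.natDegree = 2 * g) (hRH : ∀ α ∈ frobRoots h, ‖α‖ = Real.sqrt q)
    (hne : h.coeff 0 ≠ (q : ℤ) ^ g) : h.coeff g = 0 := by
  have := twistedFE_of_rh hq hh hdeg hRH g g (by omega)
  -- (c₀ - q^g) · c_g = 0
  have hmul : (h.coeff 0 - (q : ℤ) ^ g) * h.coeff g = 0 := by linear_combination this
  rcases mul_eq_zero.1 hmul with h0 | h0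
  · exact absurd (sub_eq_zero.1 h0) hne
  · exact h0

/-- **Non-vanishing middle coefficient + RH ⇒ `c₀ = q^g`.** [PROVED] -/
theorem coeff_zero_eq_of_rh_of_coeff_half_ne_zero {q : ℕ} (hq : 0 < q) {h : ℤ[X]} {g : ℕ} (hh : h.Monic)
    (hdeg : h.natDegree = 2 * g) (hRH : ∀ α ∈ frobRoots h, ‖α‖ = Real.sqrt q) (hmid : h.coeff g ≠ 0) :
    h.coeff 0 = (q : ℤ) ^ g := by
  by_contra hne
  exact hmid (coeff_half_eq_zero_of_rh_of_coeff_zero_ne hq hh hdeg hRH hne)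

/-- **Non-vanishing middle coefficient + RH ⇒ HONEST**: the coefficient functional equation holds. [PROVED] -/
theorem fe_of_rh_of_coeff_half_ne_zero {q : ℕ} (hq : 0 < q) {h : ℤ[X]} {g : ℕ} (hh : h.Monic)
    (hdeg : h.natDegree = 2 * g) (hRH : ∀ α ∈ frobRoots h, ‖α‖ = Real.sqrt q) (hmid : h.coeff g ≠ 0) :
    ∀ i j, i + j = 2 * g → (q : ℤ) ^ g * h.coeff j = (q : ℤ) ^ i * h.coeff i :=
  (fe_iff_coeff_zero_of_rh hq hh hdeg hRH).2 (coeff_zero_eq_of_rh_of_coeff_half_ne_zero hq hh hdeg hRH hmid)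

/-- **RH-true and dishonest ⟺ `c₀ = -q^g`.** [PROVED] -/
theorem not_fe_iff_coeff_zero_eq_neg_of_rh {q : ℕ} (hq : 0 < q) {h : ℤ[X]} {g : ℕ} (hh : h.Monic)
    (hdeg : h.natDegree = 2 * g) (hRH : ∀ α ∈ frobRoots h, ‖α‖ = Real.sqrt q) :
    (¬ ∀ i j, i + j = 2 * g → (q : ℤ) ^ g * h.coeff j = (q : ℤ) ^ i * h.coeff i) ↔
      h.coeff 0 = -((q : ℤ) ^ g) := by
  rw [fe_iff_coeff_zero_of_rh hq hh hdeg hRH]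
  have hqg : ((q : ℤ) ^ g) ≠ 0 := pow_ne_zero _ (by exact_mod_cast hq.ne')
  constructor
  · intro hne
    exact (coeff_zero_eq_or_eq_neg_of_rh hq hh hdeg hRH).resolve_left hne
  · intro hneg hpos
    rw [hpos] at hneg
    -- q^g = -q^g forces q^g = 0
    have : (2 : ℤ) * (q : ℤ) ^ g = 0 := by linear_combination hneg
    rcases mul_eq_zero.1 this with h2 | h2
    · norm_num at h2
    · exact hqg h2

/-- **In the dishonest branch the ANTI-functional equation holds**: `-q^g · c_j = q^i · c_i`. [PROVED] -/
theorem antiFE_of_rh_of_coeff_zero_eq_neg {q : ℕ} (hq : 0 < q) {h : ℤ[X]} {g : ℕ} (hh : h.Monic)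
    (hdeg : h.natDegree = 2 * g) (hRH : ∀ α ∈ frobRoots h, ‖α‖ = Real.sqrt q)
    (hneg : h.coeff 0 = -((q : ℤ) ^ g)) :
    ∀ i j, i + j = 2 * g → -((q : ℤ) ^ g) * h.coeff j = (q : ℤ) ^ i * h.coeff i := by
  intro i j hij
  rw [← hneg]
  exact twistedFE_of_rh hq hh hdeg hRH i j hij

/-! ## Howe 1995, Proposition (3.4), as a theorem -/

/-- **Howe, Prop. (3.4), first half: an ordinary Weil `q`-polynomial has `h(0) = q^g`** (`2g = deg h`,
`q > 0`; no condition relating `p` and `q` is needed: `p ∤ c_g` only serves to give `c_g ≠ 0`).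
[PROVED; Howe 1995, Trans. AMS 347, Prop. (3.4) p. 2367 argues via real roots `±√q` instead] -/
theorem IsOrdinaryWeilPoly.coeff_zero_eq {p q : ℕ} (hq : 0 < q) {h : ℤ[X]}
    (hord : IsOrdinaryWeilPoly p q h) : h.coeff 0 = (q : ℤ) ^ (h.natDegree / 2) := by
  obtain ⟨g, hdeg, hndvd⟩ := hord.exists_half_degree
  have hg : h.natDegree / 2 = g := by omega
  rw [hg]
  refine coeff_zero_eq_of_rh_of_coeff_half_ne_zero hq hord.monic hdeg hord.rh ?_
  intro h0
  exact hndvd (h0 ▸ dvd_zero _)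

/-- **Howe, Prop. (3.4), second half: an ordinary Weil `q`-polynomial satisfies the functional equation**
`q^g c_j = q^i c_i` (`i + j = deg h = 2g`), i.e. it is an HONEST datum of the door theorem. [PROVED] -/
theorem IsOrdinaryWeilPoly.fe {p q : ℕ} (hq : 0 < q) {h : ℤ[X]} (hord : IsOrdinaryWeilPoly p q h) :
    ∀ i j, i + j = h.natDegree →
      (q : ℤ) ^ (h.natDegree / 2) * h.coeff j = (q : ℤ) ^ i * h.coeff i := by
  obtain ⟨g, hdeg, hndvd⟩ := hord.exists_half_degree
  have hg : h.natDegree / 2 = g := by omega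
  rw [hg, hdeg]
  refine fe_of_rh_of_coeff_half_ne_zero hq hord.monic hdeg hord.rh ?_
  intro h0
  exact hndvd (h0 ▸ dvd_zero _)

/-! ## The instance `x² - q` -/

/-- `x² - q` is monic of degree `2`, with `c₀ = -q` and middle coefficient `0`. [PROVED] -/
theorem X_sq_sub_C_shape (q : ℤ) :
    (X ^ 2 - C q : ℤ[X]).Monic ∧ (X ^ 2 - C q : ℤ[X]).natDegree = 2 ∧
      (X ^ 2 - C q : ℤ[X]).coeff 0 = -q ∧ (X ^ 2 - C q : ℤ[X]).coeff 1 = 0 := by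
  refine ⟨monic_X_pow_sub_C q two_ne_zero, natDegree_X_pow_sub_C, ?_, ?_⟩
  · rw [coeff_sub, coeff_X_pow, coeff_C]; simp
  · rw [coeff_sub, coeff_X_pow, coeff_C]; simp

/-- `x² - q` is RH-true over `𝔽_q`: its roots `±√q` have absolute value `√q`. [PROVED] -/
theorem frobRoots_norm_eq_of_X_sq_sub_C (q : ℕ) :
    ∀ α ∈ frobRoots (X ^ 2 - C (q : ℤ) : ℤ[X]), ‖α‖ = Real.sqrt q := by
  intro α hα
  change α ∈ (Polynomial.map (Int.castRingHom ℂ) (X ^ 2 - C (q : ℤ))).roots at hα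
  have hne : (Polynomial.map (Int.castRingHom ℂ) (X ^ 2 - C (q : ℤ) : ℤ[X])) ≠ 0 :=
    ((monic_X_pow_sub_C (q : ℤ) two_ne_zero).map _).ne_zero
  rw [mem_roots hne, IsRoot.def] at hα
  simp only [Polynomial.map_sub, Polynomial.map_pow, Polynomial.map_X, eq_intCast, Int.cast_natCast,
    eval_sub, eval_pow, eval_X, sub_eq_zero] at hα
  -- hα : α ^ 2 = q
  have hn : ‖α‖ ^ 2 = (q : ℝ) := by
    rw [← norm_pow, hα]; simp
  rw [← Real.sqrt_sq (norm_nonneg α), hn]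

/-- **The instance**: `x² - q` (`q > 0`) is RH-true and DISHONEST — `c₀ = -q = -q^1`, middle coefficient
`0`, functional equation false; the dishonest branch of `coeff_zero_eq_or_eq_neg_of_rh` is inhabited.
[PROVED] -/
theorem X_sq_sub_C_dishonest {q : ℕ} (hq : 0 < q) :
    (∀ α ∈ frobRoots (X ^ 2 - C (q : ℤ) : ℤ[X]), ‖α‖ = Real.sqrt q) ∧
      (X ^ 2 - C (q : ℤ) : ℤ[X]).coeff 0 = -((q : ℤ) ^ 1) ∧ (X ^ 2 - C (q : ℤ) : ℤ[X]).coeff 1 = 0 ∧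
      ¬ ∀ i j, i + j = 2 * 1 →
        (q : ℤ) ^ 1 * (X ^ 2 - C (q : ℤ) : ℤ[X]).coeff j = (q : ℤ) ^ i * (X ^ 2 - C (q : ℤ) : ℤ[X]).coeff i := by
  obtain ⟨hm, hd, h0, h1⟩ := X_sq_sub_C_shape (q : ℤ)
  refine ⟨frobRoots_norm_eq_of_X_sq_sub_C q, by rw [h0, pow_one], h1, ?_⟩
  rw [not_fe_iff_coeff_zero_eq_neg_of_rh hq hm hd (frobRoots_norm_eq_of_X_sq_sub_C q), h0, pow_one]

/-- **Not ordinary**: `x² - q` is not an ordinary Weil `q`-polynomial for any `p` (its middle coefficient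
vanishes) — consistent with Howe Prop. (3.4). [PROVED] -/
theorem not_isOrdinaryWeilPoly_X_sq_sub_C (p q : ℕ) : ¬ IsOrdinaryWeilPoly p q (X ^ 2 - C (q : ℤ)) := by
  refine not_isOrdinaryWeilPoly_of_dvd_coeff_half ?_
  obtain ⟨-, hd, -, h1⟩ := X_sq_sub_C_shape (q : ℤ)
  rw [hd, show 2 / 2 = 1 from rfl, h1]
  exact dvd_zero _

end Summit.RiemannHypothesis.RiemannHypothesis.Theorems.MotivicDoor.FunctionField
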